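import Summits.BirchSwinnertonDyer.BirchSwinnertonDyer.Theorems.SignedLowerHalvesSprungLowerDivisibilityAtThreeIotaDoorContraOrbit
import HarnessLib

/-!
# Crux `SprungLowerDivisibilityAtThree` (item stmt-BirchSwinnertonDyer-19875; twin route `PrintX8VSC`: cruxes K′ 23732 / C′ 23733), line
# `chromatic-common-zeros`: THE ORBIT FORM OF THE PRINT-KEYED `ι`-DOOR, part 2 — with the natural-keyed FINE datum (door at the mirror
# prime / a mirror without zeta index ⟹ Kato's fine inequality at `𝔭`; inside the door the Main Conjecture is an EQUALITY at `𝔭`) and the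
# X8 input-free forms of the orbit equivalences

Cell `bsd-ssimc` (host), width seat `cruxlead-stmt-BirchSwinnertonDyer-19875-w2` (gen 12) under the 19875 LEAD; `--supports`
stmt-BirchSwinnertonDyer-19875 `--as helper`; theorems only (no `def`, no named fact, no instance); closes NO item. Sequel of
`…IotaDoorContraOrbit` (same seat: `m = k + j` in print keying, `k + j = k′ + j′`, door(𝔭) ⟺ door(ι𝔭) ⟺ `k + k′ ≤ m`, residue ⟺ `m < k + k′`).
Notation as there: height-one `𝔭 ∌ p`, `ι𝔭 = PrimeSpectrum.comap (invol p) 𝔭`, joint contragredient package `I, Cs, Cf` (`Cs.Z = Cf.Z`),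
`k = ℓ_𝔭(I.H ⧸ Cs.Z)`, `j = min_• ℓ_𝔭(Λ ⧸ range C•.colMap)`, `m = min_• ℓ_𝔭 Λ/(G•)`, `x′ = ℓ_𝔭 Y′.X` for `Y′ : FineSelmerDualData κ γ⁻¹`, `k′ = k(ι𝔭)`.

* §3 (package level, `ι`-stability of `(L♯, L♭)` displayed; F-α♮′ displayed in the shape consumed by `katoFineLowerAt_of_iotaDoor_contra`, i.e.
  at `ι𝔭` towards `𝔭`): `katoFineLowerAt_contra_of_mirrorDoor` (**door AT THE MIRROR `k′ ≤ j` ⟹ `k ≤ x′`**),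
  `katoFineLowerAt_contra_of_zeta_comap_invol_eq_zero` (**`k′ = 0` ⟹ `k ≤ x′`**: a sporadic common zero whose mirror prime is prime to the
  index of Kato's zeta element satisfies Kato 12.10 ⊆ at `𝔭` from F-α♮′ alone), `zeta_eq_fine_of_iotaDoor_contra_of_fine_le_zeta` (**inside the
  door, with Kato's print upper bound `x′ ≤ k` displayed as an inequality, `k = x′` and `j(𝔮) = k`** — the full Main Conjecture 12.10 at `𝔭`,
  both inclusions; the door is tight).
* §4 class X8, INPUT-FREE (`ι`-stability `ClassX8.invol_mem_span_pair`, both colours non-zero `ChromaticBothColours`, `E[3]` irreducible,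
  `ϖ ≠ 0` from `ϖ·Ω_E = Ω⁺_f`): `ClassX8.zeta_add_localIndex_eq_comap_invol_contra` (`k + j = k′ + j′`), `ClassX8.iotaDoor_contra_iff_comap_invol`,
  `ClassX8.iotaDoor_contra_iff_zeta_add_zeta_comap_invol_le`, `ClassX8.iotaResidue_contra_iff` (residue(𝔭) ⟺ residue(ι𝔭) ⟺ `m < k + k′`).

HONEST FRAMING: structure of the open residue, not progress on its content — nothing is discharged; the residue stubs, K′, C′, K1, leaf X8 and
BSD are NOT proved here. For the planners / the disprover: on class X8 the K′/C′ residue is the set of common-zero `ι`-ORBITS on which Kato's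
zeta index is carried by BOTH members and jointly EXCEEDS the common-zero multiplicity; on every other common-zero orbit Kato 12.10 ⊆ holds
at both members from the door alone, and — given Kato's upper bound — with EQUALITY.

References: [Kato2004Asterisque] Conj. 12.10 (p. 224), Thm. 12.5/12.6 (p. 222), Thm. 13.4 (p. 226), (17.13.1) (pp. 279–280); [Sprung2012]
Def. 6.1 (p. 1495), §7.1 Props. 7.3/7.6, Thm. 7.14 (3) (p. 1504), Main Conj. 7.21 (p. 1505); [Sprung2017] Thm. 4.13, Cor. 4.14;
[GreenbergLNM1716] §1; [Matar2020] Thm. 1.1; [Wingberg1989] Cor. 2.5; tree: `…IotaDoorContraOrbit` (this seat), `…IotaDoorContra` (w3 g9),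
`…KatoSporadicLedgerIota` (w3 g6).
-/

set_option linter.dupNamespace false
set_option autoImplicit false

noncomputable section

open scoped Classical NumberField MatrixGroups ModularForm

open NumberField IsDedekindDomain CongruenceSubgroup WeierstrassCurve Field
  Literature.NumberTheory.EllipticCurves Literature.NumberTheory.EllipticCurves.ModularForms
  Literature.NumberTheory.EllipticCurves.ZpExtension Literature.NumberTheory.EllipticCurves.Sprung2017
  Literature.NumberTheory.EllipticCurves.Sprung2012 Literature.NumberTheory.EllipticCurves.Rank1Residual
  Literature.NumberTheory.EllipticCurves.IwasawaAlgebra Literature.NumberTheory.EllipticCurves.Kato2004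
  Literature.NumberTheory.EllipticCurves.Module
  Summit.BirchSwinnertonDyer.BirchSwinnertonDyer.Theorems
  Summit.BirchSwinnertonDyer.BirchSwinnertonDyer.Theorems.SmallImageSignedMuDefect

namespace Summit.BirchSwinnertonDyer.BirchSwinnertonDyer.Theorems.ChromaticCommonZeros

section Package

variable (W : WeierstrassCurve ℚ) [W.IsElliptic] (p : ℕ) [Fact p.Prime]
  [ContinuousSMul ℤ_[p] (W.tateModule p)] [Module.Free ℤ_[p] (W.tateModule p)]
  [Module.Finite ℤ_[p] (W.tateModule p)]
  {N : ℕ} {f : CuspForm (Gamma0 N) 2} {ϖ : ℚ} {κ : ZpExtension ℚ p} {γ : absoluteGaloisGroup ℚ}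
  {E : Type} [Field E] [Algebra ℚ E] {ι : AlgebraicClosure ℚ →ₐ[ℚ] AlgebraicClosure E} {ap : ℤ}
  {g : absoluteGaloisGroup E} {c : ℕ → localPoints W E} {I : IwasawaH1Data W p κ γ}

/-! ### §3 With the fine datum: the door at the mirror / a mirror without zeta index give K at `𝔭`; equality inside the door -/

/-- **DOOR AT THE MIRROR ⟹ K AT `𝔭`, print keying.** Joint contragredient package (ι-stability of `(L♯, L♭)`, both colours non-zero and
normalised, `ϖ ≠ 0`, `E[p]` irreducible), a natural-keyed fine datum `Y′`, a height-one `𝔭 ∌ p`; DISPLAYED (hFα) F-α♮′ at `ι𝔭` towards `𝔭`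
(«every normalised colour vanishes at `ι𝔭` ⟹ `j(ι𝔭) ≤ x′(𝔭)`», the shape consumed by `katoFineLowerAt_of_iotaDoor_contra`). IF the door holds
AT THE MIRROR, `k(ι𝔭) ≤ j(𝔭)`, THEN Kato's fine inequality `k(𝔭) ≤ x′(𝔭)` holds AT `𝔭` (§2: door(ι𝔭) ⟺ door(𝔭), then the door theorem).
[cite: Kato2004Asterisque, Conj. 12.10 (p. 224), (17.13.1) (p. 280)] [cite: Sprung2012, §7.1, Props. 7.3/7.6, Thm. 7.14 (3)]
[cite: Matar2020, Thm. 1.1] [cite: GreenbergLNM1716, §1] -/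
theorem katoFineLowerAt_contra_of_mirrorDoor
    (Cs : SharpFlatColemanKatoDataContra W p f ϖ κ γ ι ap g c Chroma.sharp I)
    (Cf : SharpFlatColemanKatoDataContra W p f ϖ κ γ ι ap g c Chroma.flat I) (hZ : Cs.Z = Cf.Z)
    (hirr : W.HasIrreducibleModPGaloisRep p) (hϖ : ϖ ≠ 0) {Lsharp Lflat Gs Gf : IwasawaAlgebra p}
    (hSP : IsSprungPair f p ap Lsharp Lflat) (hs0 : Lsharp ≠ 0) (hf0 : Lflat ≠ 0)
    (hGs : iwasawaToPowerSeries p Gs =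
      PowerSeries.C ((ϖ : ℚ) : ℚ_[p]) * iwasawaToPowerSeries p (chromaticL Chroma.sharp Lsharp Lflat))
    (hGf : iwasawaToPowerSeries p Gf =
      PowerSeries.C ((ϖ : ℚ) : ℚ_[p]) * iwasawaToPowerSeries p (chromaticL Chroma.flat Lsharp Lflat))
    (hJ : ∀ x ∈ Ideal.span ({Lsharp, Lflat} : Set (IwasawaAlgebra p)),
      invol p x ∈ Ideal.span ({Lsharp, Lflat} : Set (IwasawaAlgebra p)))
    (Y : W.FineSelmerDualData κ γ⁻¹) (𝔭 : PrimeSpectrum (IwasawaAlgebra p)) (h𝔭 : 𝔭.asIdeal.height = 1)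
    (hp𝔭 : (p : IwasawaAlgebra p) ∉ 𝔭.asIdeal)
    (hFα : (∀ (col' : Chroma) (G' : IwasawaAlgebra p),
        iwasawaToPowerSeries p G' =
          PowerSeries.C ((ϖ : ℚ) : ℚ_[p]) * iwasawaToPowerSeries p (chromaticL col' Lsharp Lflat) →
        G' ∈ (PrimeSpectrum.comap (invol p).toRingHom 𝔭).asIdeal) →
      min (Module.lengthAt (IwasawaAlgebra p) (IwasawaAlgebra p ⧸ LinearMap.range Cs.colMap)
            (PrimeSpectrum.comap (invol p).toRingHom 𝔭))
          (Module.lengthAt (IwasawaAlgebra p) (IwasawaAlgebra p ⧸ LinearMap.range Cf.colMap)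
            (PrimeSpectrum.comap (invol p).toRingHom 𝔭)) ≤
        Module.lengthAt (IwasawaAlgebra p) Y.X 𝔭)
    (hmirror : Module.lengthAt (IwasawaAlgebra p) (I.H ⧸ Cs.Z) (PrimeSpectrum.comap (invol p).toRingHom 𝔭) ≤
      min (Module.lengthAt (IwasawaAlgebra p) (IwasawaAlgebra p ⧸ LinearMap.range Cs.colMap) 𝔭)
          (Module.lengthAt (IwasawaAlgebra p) (IwasawaAlgebra p ⧸ LinearMap.range Cf.colMap) 𝔭)) :
    Module.lengthAt (IwasawaAlgebra p) (I.H ⧸ Cs.Z) 𝔭 ≤ Module.lengthAt (IwasawaAlgebra p) Y.X 𝔭 := by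
  have hcs : chromaticL Chroma.sharp Lsharp Lflat ≠ 0 := by rwa [chromaticL_sharp]
  have hcf : chromaticL Chroma.flat Lsharp Lflat ≠ 0 := by rwa [chromaticL_flat]
  have h𝔮1 : (PrimeSpectrum.comap (invol p).toRingHom 𝔭).asIdeal.height = 1 := by
    rw [Kato2004.height_comap_invol, h𝔭]
  have hdoor := (iotaDoor_contra_iff_comap_invol W p Cs Cf hZ hirr hϖ hSP hs0 hf0 hGs hGf hJ 𝔭 h𝔭 hp𝔭).mpr hmirror
  exact katoFineLowerAt_of_iotaDoor_contra W p Cs Cf hirr hSP hcs hcf Y 𝔭 (PrimeSpectrum.comap (invol p).toRingHom 𝔭) h𝔮1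
    hFα hdoor

/-- **A MIRROR WITHOUT ZETA INDEX ⟹ K AT `𝔭`, print keying.** Same situation; IF `k(ι𝔭) = 0` THEN `k(𝔭) ≤ x′(𝔭)`: a sporadic common zero
whose mirror prime is prime to the index of Kato's zeta element satisfies Kato's Main Conjecture 12.10 ⊆ at `𝔭` from F-α♮′ alone.
[cite: Kato2004Asterisque, Conj. 12.10 (p. 224), Thm. 12.6 (p. 222), (17.13.1) (p. 280)] [cite: Sprung2012, §7.1, Thm. 7.14 (3)]
[cite: Matar2020, Thm. 1.1] [cite: GreenbergLNM1716, §1] -/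
theorem katoFineLowerAt_contra_of_zeta_comap_invol_eq_zero
    (Cs : SharpFlatColemanKatoDataContra W p f ϖ κ γ ι ap g c Chroma.sharp I)
    (Cf : SharpFlatColemanKatoDataContra W p f ϖ κ γ ι ap g c Chroma.flat I) (hZ : Cs.Z = Cf.Z)
    (hirr : W.HasIrreducibleModPGaloisRep p) (hϖ : ϖ ≠ 0) {Lsharp Lflat Gs Gf : IwasawaAlgebra p}
    (hSP : IsSprungPair f p ap Lsharp Lflat) (hs0 : Lsharp ≠ 0) (hf0 : Lflat ≠ 0)
    (hGs : iwasawaToPowerSeries p Gs =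
      PowerSeries.C ((ϖ : ℚ) : ℚ_[p]) * iwasawaToPowerSeries p (chromaticL Chroma.sharp Lsharp Lflat))
    (hGf : iwasawaToPowerSeries p Gf =
      PowerSeries.C ((ϖ : ℚ) : ℚ_[p]) * iwasawaToPowerSeries p (chromaticL Chroma.flat Lsharp Lflat))
    (hJ : ∀ x ∈ Ideal.span ({Lsharp, Lflat} : Set (IwasawaAlgebra p)),
      invol p x ∈ Ideal.span ({Lsharp, Lflat} : Set (IwasawaAlgebra p)))
    (Y : W.FineSelmerDualData κ γ⁻¹) (𝔭 : PrimeSpectrum (IwasawaAlgebra p)) (h𝔭 : 𝔭.asIdeal.height = 1)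
    (hp𝔭 : (p : IwasawaAlgebra p) ∉ 𝔭.asIdeal)
    (hFα : (∀ (col' : Chroma) (G' : IwasawaAlgebra p),
        iwasawaToPowerSeries p G' =
          PowerSeries.C ((ϖ : ℚ) : ℚ_[p]) * iwasawaToPowerSeries p (chromaticL col' Lsharp Lflat) →
        G' ∈ (PrimeSpectrum.comap (invol p).toRingHom 𝔭).asIdeal) →
      min (Module.lengthAt (IwasawaAlgebra p) (IwasawaAlgebra p ⧸ LinearMap.range Cs.colMap)
            (PrimeSpectrum.comap (invol p).toRingHom 𝔭))
          (Module.lengthAt (IwasawaAlgebra p) (IwasawaAlgebra p ⧸ LinearMap.range Cf.colMap)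
            (PrimeSpectrum.comap (invol p).toRingHom 𝔭)) ≤
        Module.lengthAt (IwasawaAlgebra p) Y.X 𝔭)
    (hk' : Module.lengthAt (IwasawaAlgebra p) (I.H ⧸ Cs.Z) (PrimeSpectrum.comap (invol p).toRingHom 𝔭) = 0) :
    Module.lengthAt (IwasawaAlgebra p) (I.H ⧸ Cs.Z) 𝔭 ≤ Module.lengthAt (IwasawaAlgebra p) Y.X 𝔭 := by
  refine katoFineLowerAt_contra_of_mirrorDoor W p Cs Cf hZ hirr hϖ hSP hs0 hf0 hGs hGf hJ Y 𝔭 h𝔭 hp𝔭 hFα ?_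
  rw [hk']
  exact bot_le

/-- **INSIDE THE DOOR THE MAIN CONJECTURE IS AN EQUALITY AT `𝔭`, print keying.** Contragredient joint package, both colours non-zero,
`E[p]` irreducible, natural-keyed fine datum `Y′`, primes `𝔭` and a height-one `𝔮` (in the line `𝔮 = ι𝔭`); DISPLAYED: (hFα) F-α♮′ at `𝔮`
towards `𝔭`, (hdoor) `k(𝔭) ≤ j(𝔮)`, and (hKato) Kato's print upper bound `x′(𝔭) ≤ k(𝔭)` (Thm. 12.5 / 13.4 for the natural-keyed fine dual,
displayed as an inequality, no named fact consumed). IF every normalised colour vanishes at `𝔮` THEN `k(𝔭) = x′(𝔭)` AND `j(𝔮) = k(𝔭)`: the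
chain `k ≤ j(𝔮) ≤ x′ ≤ k` collapses — Kato's Main Conjecture 12.10 holds at `𝔭` with BOTH inclusions, and the door is tight.
[cite: Kato2004Asterisque, Conj. 12.10 (p. 224), Thm. 12.5 (p. 222), Thm. 13.4 (p. 226)] [cite: Sprung2012, §7.1, Thm. 7.14 (3), Main Conj. 7.21 (p. 1505)]
[cite: Matar2020, Thm. 1.1] -/
theorem zeta_eq_fine_of_iotaDoor_contra_of_fine_le_zeta
    (Cs : SharpFlatColemanKatoDataContra W p f ϖ κ γ ι ap g c Chroma.sharp I)
    (Cf : SharpFlatColemanKatoDataContra W p f ϖ κ γ ι ap g c Chroma.flat I)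
    {Lsharp Lflat : IwasawaAlgebra p}
    (Y : W.FineSelmerDualData κ γ⁻¹) (𝔭 𝔮 : PrimeSpectrum (IwasawaAlgebra p))
    (hFα : (∀ (col' : Chroma) (G' : IwasawaAlgebra p),
        iwasawaToPowerSeries p G' =
          PowerSeries.C ((ϖ : ℚ) : ℚ_[p]) * iwasawaToPowerSeries p (chromaticL col' Lsharp Lflat) →
        G' ∈ 𝔮.asIdeal) →
      min (Module.lengthAt (IwasawaAlgebra p) (IwasawaAlgebra p ⧸ LinearMap.range Cs.colMap) 𝔮)
          (Module.lengthAt (IwasawaAlgebra p) (IwasawaAlgebra p ⧸ LinearMap.range Cf.colMap) 𝔮) ≤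
        Module.lengthAt (IwasawaAlgebra p) Y.X 𝔭)
    (hcommon𝔮 : ∀ (col' : Chroma) (G' : IwasawaAlgebra p),
        iwasawaToPowerSeries p G' =
          PowerSeries.C ((ϖ : ℚ) : ℚ_[p]) * iwasawaToPowerSeries p (chromaticL col' Lsharp Lflat) →
        G' ∈ 𝔮.asIdeal)
    (hdoor : Module.lengthAt (IwasawaAlgebra p) (I.H ⧸ Cs.Z) 𝔭 ≤
      min (Module.lengthAt (IwasawaAlgebra p) (IwasawaAlgebra p ⧸ LinearMap.range Cs.colMap) 𝔮)
          (Module.lengthAt (IwasawaAlgebra p) (IwasawaAlgebra p ⧸ LinearMap.range Cf.colMap) 𝔮))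
    (hKato : Module.lengthAt (IwasawaAlgebra p) Y.X 𝔭 ≤ Module.lengthAt (IwasawaAlgebra p) (I.H ⧸ Cs.Z) 𝔭) :
    Module.lengthAt (IwasawaAlgebra p) (I.H ⧸ Cs.Z) 𝔭 = Module.lengthAt (IwasawaAlgebra p) Y.X 𝔭 ∧
      min (Module.lengthAt (IwasawaAlgebra p) (IwasawaAlgebra p ⧸ LinearMap.range Cs.colMap) 𝔮)
          (Module.lengthAt (IwasawaAlgebra p) (IwasawaAlgebra p ⧸ LinearMap.range Cf.colMap) 𝔮) =
        Module.lengthAt (IwasawaAlgebra p) (I.H ⧸ Cs.Z) 𝔭 := by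
  have hjx := hFα hcommon𝔮
  exact ⟨le_antisymm (hdoor.trans hjx) hKato, le_antisymm (hjx.trans hKato) hdoor⟩

end Package

/-! ### §4 Class X8: input-free forms (print keying) -/

section X8Package

variable (W : WeierstrassCurve ℚ) [W.IsElliptic] [W.IsGloballyMinimal] (p : ℕ) [Fact p.Prime]
  [ContinuousSMul ℤ_[p] (W.tateModule p)] [Module.Free ℤ_[p] (W.tateModule p)]
  [Module.Finite ℤ_[p] (W.tateModule p)]
  {N : ℕ} [NeZero N] {f : CuspForm (Gamma0 N) 2} {ϖ : ℚ} {κ : ZpExtension ℚ p} {γ : absoluteGaloisGroup ℚ}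
  {E : Type} [Field E] [Algebra ℚ E] {ι : AlgebraicClosure ℚ →ₐ[ℚ] AlgebraicClosure E}
  {g : absoluteGaloisGroup E} {c : ℕ → localPoints W E} {I : IwasawaH1Data W p κ γ}

/-- **On class X8: `k(𝔭) + j(𝔭) = k(ι𝔭) + j(ι𝔭)` at every height-one `𝔭 ∌ p`, PRINT KEYING** — joint contragredient package of an X8 pair,
its newform `f` with period ratio `ϖ` (`ϖ·Ω_E = Ω⁺_f`), its Sprung pair and Néron-normalised `Gs, Gf`; INPUT-FREE (`ι`-stability of
`(L♯, L♭)`: `ClassX8.invol_mem_span_pair`; both colours non-zero: `ChromaticBothColours`; `E[3]` irreducible: supersingular).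
[cite: Sprung2017, Thm. 4.13, Cor. 4.14] [cite: Kato2004Asterisque, Thm. 12.6 (p. 222), (17.13.1) (p. 280)] [cite: Sprung2012, §7.1, Thm. 7.14 (3)] -/
theorem ClassX8.zeta_add_localIndex_eq_comap_invol_contra (hX : ClassX8 W p)
    (Cs : SharpFlatColemanKatoDataContra W p f ϖ κ γ ι (W.frobeniusTrace p) g c Chroma.sharp I)
    (Cf : SharpFlatColemanKatoDataContra W p f ϖ κ γ ι (W.frobeniusTrace p) g c Chroma.flat I) (hZ : Cs.Z = Cf.Z)
    {Lsharp Lflat Gs Gf : IwasawaAlgebra p} (hf : IsNewformOf W f) (hϖ : (ϖ : ℝ) * W.realPeriodRat = plusPeriod f)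
    (hSP : IsSprungPair f p (W.frobeniusTrace p) Lsharp Lflat)
    (hGs : iwasawaToPowerSeries p Gs =
      PowerSeries.C ((ϖ : ℚ) : ℚ_[p]) * iwasawaToPowerSeries p (chromaticL Chroma.sharp Lsharp Lflat))
    (hGf : iwasawaToPowerSeries p Gf =
      PowerSeries.C ((ϖ : ℚ) : ℚ_[p]) * iwasawaToPowerSeries p (chromaticL Chroma.flat Lsharp Lflat))
    (𝔭 : PrimeSpectrum (IwasawaAlgebra p)) (h𝔭 : 𝔭.asIdeal.height = 1)
    (hp𝔭 : (p : IwasawaAlgebra p) ∉ 𝔭.asIdeal) :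
    Module.lengthAt (IwasawaAlgebra p) (I.H ⧸ Cs.Z) 𝔭 +
        min (Module.lengthAt (IwasawaAlgebra p) (IwasawaAlgebra p ⧸ LinearMap.range Cs.colMap) 𝔭)
          (Module.lengthAt (IwasawaAlgebra p) (IwasawaAlgebra p ⧸ LinearMap.range Cf.colMap) 𝔭) =
      Module.lengthAt (IwasawaAlgebra p) (I.H ⧸ Cs.Z) (PrimeSpectrum.comap (invol p).toRingHom 𝔭) +
        min (Module.lengthAt (IwasawaAlgebra p) (IwasawaAlgebra p ⧸ LinearMap.range Cs.colMap)
            (PrimeSpectrum.comap (invol p).toRingHom 𝔭))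
          (Module.lengthAt (IwasawaAlgebra p) (IwasawaAlgebra p ⧸ LinearMap.range Cf.colMap)
            (PrimeSpectrum.comap (invol p).toRingHom 𝔭)) := by
  obtain ⟨hs0, hf0⟩ :=
    ChromaticBothColours.ClassX8.sharp_ne_zero_and_flat_ne_zero W p hX N inferInstance f Lsharp Lflat hf hSP
  exact ChromaticCommonZeros.zeta_add_localIndex_eq_comap_invol_contra_of_invol_mem W p Cs Cf hZ (ClassX8.irr' W p hX)
    (hf.periodRatio_ne_zero hϖ) hSP hs0 hf0 hGs hGf (ClassX8.invol_mem_span_pair W p hX f Lsharp Lflat hf hSP) 𝔭 h𝔭 hp𝔭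

/-- **On class X8: door(𝔭) ⟺ door(ι𝔭), print keying, input-free.** [cite: Kato2004Asterisque, Conj. 12.10 (p. 224)]
[cite: Sprung2017, Thm. 4.13, Cor. 4.14] [cite: Sprung2012, §7.1, Thm. 7.14 (3)] -/
theorem ClassX8.iotaDoor_contra_iff_comap_invol (hX : ClassX8 W p)
    (Cs : SharpFlatColemanKatoDataContra W p f ϖ κ γ ι (W.frobeniusTrace p) g c Chroma.sharp I)
    (Cf : SharpFlatColemanKatoDataContra W p f ϖ κ γ ι (W.frobeniusTrace p) g c Chroma.flat I) (hZ : Cs.Z = Cf.Z)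
    {Lsharp Lflat Gs Gf : IwasawaAlgebra p} (hf : IsNewformOf W f) (hϖ : (ϖ : ℝ) * W.realPeriodRat = plusPeriod f)
    (hSP : IsSprungPair f p (W.frobeniusTrace p) Lsharp Lflat)
    (hGs : iwasawaToPowerSeries p Gs =
      PowerSeries.C ((ϖ : ℚ) : ℚ_[p]) * iwasawaToPowerSeries p (chromaticL Chroma.sharp Lsharp Lflat))
    (hGf : iwasawaToPowerSeries p Gf =
      PowerSeries.C ((ϖ : ℚ) : ℚ_[p]) * iwasawaToPowerSeries p (chromaticL Chroma.flat Lsharp Lflat))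
    (𝔭 : PrimeSpectrum (IwasawaAlgebra p)) (h𝔭 : 𝔭.asIdeal.height = 1)
    (hp𝔭 : (p : IwasawaAlgebra p) ∉ 𝔭.asIdeal) :
    Module.lengthAt (IwasawaAlgebra p) (I.H ⧸ Cs.Z) 𝔭 ≤
        min (Module.lengthAt (IwasawaAlgebra p) (IwasawaAlgebra p ⧸ LinearMap.range Cs.colMap)
            (PrimeSpectrum.comap (invol p).toRingHom 𝔭))
          (Module.lengthAt (IwasawaAlgebra p) (IwasawaAlgebra p ⧸ LinearMap.range Cf.colMap)
            (PrimeSpectrum.comap (invol p).toRingHom 𝔭)) ↔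
      Module.lengthAt (IwasawaAlgebra p) (I.H ⧸ Cs.Z) (PrimeSpectrum.comap (invol p).toRingHom 𝔭) ≤
        min (Module.lengthAt (IwasawaAlgebra p) (IwasawaAlgebra p ⧸ LinearMap.range Cs.colMap) 𝔭)
          (Module.lengthAt (IwasawaAlgebra p) (IwasawaAlgebra p ⧸ LinearMap.range Cf.colMap) 𝔭) := by
  obtain ⟨hs0, hf0⟩ :=
    ChromaticBothColours.ClassX8.sharp_ne_zero_and_flat_ne_zero W p hX N inferInstance f Lsharp Lflat hf hSP
  exact ChromaticCommonZeros.iotaDoor_contra_iff_comap_invol W p Cs Cf hZ (ClassX8.irr' W p hX) (hf.periodRatio_ne_zero hϖ) hSP hs0 hf0 hGs hGf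
    (ClassX8.invol_mem_span_pair W p hX f Lsharp Lflat hf hSP) 𝔭 h𝔭 hp𝔭

/-- **On class X8: door ⟺ `k(𝔭) + k(ι𝔭) ≤ m(𝔭)`, print keying, input-free.** [cite: Kato2004Asterisque, Conj. 12.10 (p. 224), Thm. 12.6 (p. 222)]
[cite: Sprung2017, Thm. 4.13, Cor. 4.14] [cite: Sprung2012, Def. 6.1, §7.1, Thm. 7.14 (3)] -/
theorem ClassX8.iotaDoor_contra_iff_zeta_add_zeta_comap_invol_le (hX : ClassX8 W p)
    (Cs : SharpFlatColemanKatoDataContra W p f ϖ κ γ ι (W.frobeniusTrace p) g c Chroma.sharp I)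
    (Cf : SharpFlatColemanKatoDataContra W p f ϖ κ γ ι (W.frobeniusTrace p) g c Chroma.flat I) (hZ : Cs.Z = Cf.Z)
    {Lsharp Lflat Gs Gf : IwasawaAlgebra p} (hf : IsNewformOf W f) (hϖ : (ϖ : ℝ) * W.realPeriodRat = plusPeriod f)
    (hSP : IsSprungPair f p (W.frobeniusTrace p) Lsharp Lflat)
    (hGs : iwasawaToPowerSeries p Gs =
      PowerSeries.C ((ϖ : ℚ) : ℚ_[p]) * iwasawaToPowerSeries p (chromaticL Chroma.sharp Lsharp Lflat))
    (hGf : iwasawaToPowerSeries p Gf =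
      PowerSeries.C ((ϖ : ℚ) : ℚ_[p]) * iwasawaToPowerSeries p (chromaticL Chroma.flat Lsharp Lflat))
    (𝔭 : PrimeSpectrum (IwasawaAlgebra p)) (h𝔭 : 𝔭.asIdeal.height = 1)
    (hp𝔭 : (p : IwasawaAlgebra p) ∉ 𝔭.asIdeal) :
    Module.lengthAt (IwasawaAlgebra p) (I.H ⧸ Cs.Z) 𝔭 ≤
        min (Module.lengthAt (IwasawaAlgebra p) (IwasawaAlgebra p ⧸ LinearMap.range Cs.colMap)
            (PrimeSpectrum.comap (invol p).toRingHom 𝔭))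
          (Module.lengthAt (IwasawaAlgebra p) (IwasawaAlgebra p ⧸ LinearMap.range Cf.colMap)
            (PrimeSpectrum.comap (invol p).toRingHom 𝔭)) ↔
      Module.lengthAt (IwasawaAlgebra p) (I.H ⧸ Cs.Z) 𝔭 +
          Module.lengthAt (IwasawaAlgebra p) (I.H ⧸ Cs.Z) (PrimeSpectrum.comap (invol p).toRingHom 𝔭) ≤
        min (Module.lengthAt (IwasawaAlgebra p) (IwasawaAlgebra p ⧸ Ideal.span {Gs}) 𝔭)
          (Module.lengthAt (IwasawaAlgebra p) (IwasawaAlgebra p ⧸ Ideal.span {Gf}) 𝔭) := by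
  obtain ⟨hs0, hf0⟩ :=
    ChromaticBothColours.ClassX8.sharp_ne_zero_and_flat_ne_zero W p hX N inferInstance f Lsharp Lflat hf hSP
  exact ChromaticCommonZeros.iotaDoor_contra_iff_zeta_add_zeta_comap_invol_le W p Cs Cf hZ (ClassX8.irr' W p hX) (hf.periodRatio_ne_zero hϖ) hSP
    hs0 hf0 hGs hGf (ClassX8.invol_mem_span_pair W p hX f Lsharp Lflat hf hSP) 𝔭 h𝔭 hp𝔭

/-- **On class X8: residue(𝔭) ⟺ residue(ι𝔭) ⟺ `m(𝔭) < k(𝔭) + k(ι𝔭)`, print keying, input-free** (stated as the two `↔`).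
[cite: Kato2004Asterisque, Conj. 12.10 (p. 224)] [cite: Sprung2017, Thm. 4.13, Cor. 4.14] [cite: Sprung2012, Def. 6.1, Main Conj. 7.21 (p. 1505)] -/
theorem ClassX8.iotaResidue_contra_iff (hX : ClassX8 W p)
    (Cs : SharpFlatColemanKatoDataContra W p f ϖ κ γ ι (W.frobeniusTrace p) g c Chroma.sharp I)
    (Cf : SharpFlatColemanKatoDataContra W p f ϖ κ γ ι (W.frobeniusTrace p) g c Chroma.flat I) (hZ : Cs.Z = Cf.Z)
    {Lsharp Lflat Gs Gf : IwasawaAlgebra p} (hf : IsNewformOf W f) (hϖ : (ϖ : ℝ) * W.realPeriodRat = plusPeriod f)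
    (hSP : IsSprungPair f p (W.frobeniusTrace p) Lsharp Lflat)
    (hGs : iwasawaToPowerSeries p Gs =
      PowerSeries.C ((ϖ : ℚ) : ℚ_[p]) * iwasawaToPowerSeries p (chromaticL Chroma.sharp Lsharp Lflat))
    (hGf : iwasawaToPowerSeries p Gf =
      PowerSeries.C ((ϖ : ℚ) : ℚ_[p]) * iwasawaToPowerSeries p (chromaticL Chroma.flat Lsharp Lflat))
    (𝔭 : PrimeSpectrum (IwasawaAlgebra p)) (h𝔭 : 𝔭.asIdeal.height = 1)
    (hp𝔭 : (p : IwasawaAlgebra p) ∉ 𝔭.asIdeal) :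
    (min (Module.lengthAt (IwasawaAlgebra p) (IwasawaAlgebra p ⧸ LinearMap.range Cs.colMap)
              (PrimeSpectrum.comap (invol p).toRingHom 𝔭))
            (Module.lengthAt (IwasawaAlgebra p) (IwasawaAlgebra p ⧸ LinearMap.range Cf.colMap)
              (PrimeSpectrum.comap (invol p).toRingHom 𝔭)) <
          Module.lengthAt (IwasawaAlgebra p) (I.H ⧸ Cs.Z) 𝔭 ↔
        min (Module.lengthAt (IwasawaAlgebra p) (IwasawaAlgebra p ⧸ LinearMap.range Cs.colMap) 𝔭)
            (Module.lengthAt (IwasawaAlgebra p) (IwasawaAlgebra p ⧸ LinearMap.range Cf.colMap) 𝔭) <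
          Module.lengthAt (IwasawaAlgebra p) (I.H ⧸ Cs.Z) (PrimeSpectrum.comap (invol p).toRingHom 𝔭)) ∧
      (min (Module.lengthAt (IwasawaAlgebra p) (IwasawaAlgebra p ⧸ LinearMap.range Cs.colMap)
              (PrimeSpectrum.comap (invol p).toRingHom 𝔭))
            (Module.lengthAt (IwasawaAlgebra p) (IwasawaAlgebra p ⧸ LinearMap.range Cf.colMap)
              (PrimeSpectrum.comap (invol p).toRingHom 𝔭)) <
          Module.lengthAt (IwasawaAlgebra p) (I.H ⧸ Cs.Z) 𝔭 ↔
        min (Module.lengthAt (IwasawaAlgebra p) (IwasawaAlgebra p ⧸ Ideal.span {Gs}) 𝔭)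
            (Module.lengthAt (IwasawaAlgebra p) (IwasawaAlgebra p ⧸ Ideal.span {Gf}) 𝔭) <
          Module.lengthAt (IwasawaAlgebra p) (I.H ⧸ Cs.Z) 𝔭 +
            Module.lengthAt (IwasawaAlgebra p) (I.H ⧸ Cs.Z) (PrimeSpectrum.comap (invol p).toRingHom 𝔭)) := by
  obtain ⟨hs0, hf0⟩ :=
    ChromaticBothColours.ClassX8.sharp_ne_zero_and_flat_ne_zero W p hX N inferInstance f Lsharp Lflat hf hSP
  exact ⟨ChromaticCommonZeros.iotaResidue_contra_iff_comap_invol W p Cs Cf hZ (ClassX8.irr' W p hX) (hf.periodRatio_ne_zero hϖ) hSP hs0 hf0 hGs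
      hGf (ClassX8.invol_mem_span_pair W p hX f Lsharp Lflat hf hSP) 𝔭 h𝔭 hp𝔭,
    ChromaticCommonZeros.iotaResidue_contra_iff_lt_zeta_add_zeta_comap_invol W p Cs Cf hZ (ClassX8.irr' W p hX) (hf.periodRatio_ne_zero hϖ) hSP
      hs0 hf0 hGs hGf (ClassX8.invol_mem_span_pair W p hX f Lsharp Lflat hf hSP) 𝔭 h𝔭 hp𝔭⟩

end X8Package

end Summit.BirchSwinnertonDyer.BirchSwinnertonDyer.Theorems.ChromaticCommonZeros

end
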